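/-
Origin: expansion seat `planner-pub-hodgecm-mc-axioms-1-g14-0`, handover #W241 2026-08-20T15:53:55Z md5 3c9319d9e136 (PKG 415b39d9b1a8 → 3c9319d9e136; 226 l.; MECHANICAL (iib-R) rewrite v3.1 of the PKG file as it stands (10 token edits; rules R1x1+RX[h₂]x9)) (`HOME/mc/pub-hodgecm-mc-axioms-1-g14/revendor/kit-r55/stage55/HodgeCM/Model/Binders/Real34Census.lean`, md5 3c9319d9e136, 226 lines);
landed by the gen-22 packager (p-g22) in gate run 55 REPLACES the earlier landed copy of `HodgeCM/Model/Binders/Real34Census.lean` (seat copy carried the packager Origin header of an earlier run (stripped)).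
-/
/-
Origin: speedrun cell pub-hodgecm, MODEL-CONSTRUCTION sub-cell, unit pub-hodgecm-mc-binder-1-g12 (BINDER PROVER, gen 12; row 17 `real34`:
the census-T record from binder-2's EXPLICIT (34) core — the socket glue-1 instantiates), seat prover-pub-hodgecm-mc-binder-1-g12-0, 2026-08-20.
Target in PKG: HodgeCM/Model/Binders/Real34Census.lean (NEW additive leaf; imports RUN-48 #55 `Binders/Real34TauTensor` only).  KERNEL ONLY: 1 def
(binder-2's (34) core TERM of `nonempty_hypCoreW₃₄_wmInputCM₂g`, as a `def`) + 1 theorem + 1 def-valued constructor; 0 records, nothing cited,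
0 `def … : Prop`; MODEL-N ±0; E unchanged.  Nothing here is a claim of the manuscripts under adjudication.
-/
import Summits.HodgeConjecture.HodgeCM.Model.Binders.Real34TauTensor

/-!
# Row 17's census-T record from binder-2's explicit (34) core

binder-2's `HypCensus.nonempty_hypCoreW₃₄_wmInputCM₂g (hV) (hW) (jD) (m₁ m₂) (hκ) (homg₃₄) (hdense)` proves `Nonempty (HypCoreW …)` by an
EXPLICIT structure literal whose insertion is `ins₃₄`.  § 1 names that literal — **`HypCensus.coreW₃₄Of … : HypCoreW …`** (same fields, same
proofs) — so that the identification `hcore` of RUN-48 #54/#55 is `⟨f, rfl⟩` (`coreW₃₄Of_ins`).  § 2 is the SOCKET for glue-1: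
**`Gen12PinsP.Real34CensusSideT.ofCensus`** — row 17's `CT` per good sextic context from EXACTLY: the rows-18/19 residual families `hκ`,
`homg₃₄`, `hdense` of the (34) core (E's existing binders), LF-continuity of the two (34) pair actions of the guarded S pin, (W-0-supply)
`hsupply` (carch-1's At-tower), and the archimedean letter identity `harch` (existential form of #55: some pure-tensor factorisation of `tau34` with the letter identity) — no core, no `hcore`, no `hins`, no theta period.
-/

set_option autoImplicit false

noncomputable section

open MeasureTheory NumberField MulAction IsDedekindDomain
open scoped NumberField
open scoped Matrix InnerProductSpace TensorProduct Classical

attribute [-instance] Quotient.instMeasurableSpace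

/-! ## 1. binder-2's (34) core as a term -/

namespace HodgeCM.Model.HypCensus

open Filter Topology
open NumberField.InfinitePlace
open Literature.NumberTheory.Automorphic Literature.NumberTheory.Automorphic.UnitaryGroup Literature.NumberTheory.Weil1964
open Literature.RepresentationTheory.KonnoKonno2007 Literature.RepresentationTheory.KonnoKonno2007.RealDualPair
open Literature.NumberTheory.GelbartRogawski1991 Literature.NumberTheory.GelbartRogawski1991.UnitaryDualPair
open Literature.Analysis.SegalBargmann
open HodgeCM HodgeCM.Model HodgeCM.Adelic
open HodgeCM.PerL34 HodgeCM.PerL34.ArchC HodgeCM.PerL34.Fock HodgeCM.PerL34.Fock.PrintDict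
open NumberField.SeesawArchTorus

section Pin

variable {L : CMField} {ι₁ : L →+* ℂ} (V : HermSpace3 L ι₁) (S : StubTree.SeesawDatum L)
variable
  (hGR : (cmSplittingDatum (L : Type) finProdFinEquiv (frameD V) (frameD_real V) (frameD_ne V) (dW S) (dW_real S) (dW_ne S)).CompatibleSplitting)
  (η : CMAdelic (L : Type) (frameD V) × CMAdelic (L : Type) (dW S) →* ℂˣ)
  (hη : ∀ γU ∈ CMRat (L : Type) (frameD V), ∀ γ ∈ CMRat (L : Type) (dW S), η (γU, γ) = 1)
  (hηc : Continuous fun p => ((η p : ℂˣ) : ℂ))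
  (hV : IsAnisotropic L V.Hm)
  (hW : (∀ j, 0 < (ι₁ ((dW S) j)).re) ∨ ∀ j, (ι₁ ((dW S) j)).re < 0)
variable (jD : InfinitePlace (L : Type) → HodgeCM.PerL34.Fock.EqVar → Fin 6) (m₁ m₂ : InfinitePlace (L : Type) → ℤ)
variable
  (hκ : ∀ k : ↥(KInfty V),
    ((η (kPair V S ι₁ V.sylvesterFrame (sylvesterFrame_formCongr V) k) : ℂˣ) : ℂ) *
        ((pinLetterChar V S hGR hW (kVLetters V S (lett V S k)) : Circle) : ℂ) * dVIota V S (lett V S k (cmPlace (L : Type) ι₁)) =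
      ((UnitaryGroup.archKappa (L : Type) V.Hm ι₁ V.sylvesterFrame (sylvesterFrame_formCongr V) k : ℂˣ) : ℂ))

/-- **binder-2's (34) census core, as a term**: the structure literal of `nonempty_hypCoreW₃₄_wmInputCM₂g` (`FinIdx := FinSB`,
`ins := ins₃₄ …`, `ins_mem`, `dense := dense₃₄_of_dense hdense`, `omg_ins := homg₃₄`, `e := curve₃₄`, `e_zero`, `smooth`). -/
def coreW₃₄Of
    (homg₃₄ : ∀ (f : FinSB ↥(maximalRealSubfield L) (Fin 6)) (t : (printedAt V S hW jD m₁ m₂).Tg) (φ : (printedAt V S hW jD m₁ m₂).F),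
      omgW (wmInputCM₂g V S hGR η hη hηc ι₁ V.sylvesterFrame (sylvesterFrame_formCongr V))
          (printedTorusHom (kindOf (L : Type) (frameD V) (frameD_real V) (dW S) (dW_real S) ι₁ (datumAt V S jD (jIOf V S hW)))
            (lamOf (L : Type) (frameD V) (frameD_real V) (dW S) (dW_real S) ι₁ (datumAt V S jD (jIOf V S hW)))
            (lamOf_ne_zero (L : Type) (frameD V) (frameD_real V) (dW S) (dW_real S) ι₁ (datumAt V S jD (jIOf V S hW)))
            (S.jT₃₄.toMonoidHom.comp (toAdeles (L : Type)))
            (pinnedVacs (kindOf (L : Type) (frameD V) (frameD_real V) (dW S) (dW_real S) ι₁ (datumAt V S jD (jIOf V S hW))) m₁ m₂) t)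
          (ins₃₄ V S hGR η (datumAt V S jD (jIOf V S hW)) m₁ m₂ f φ) =
        ins₃₄ V S hGR η (datumAt V S jD (jIOf V S hW)) m₁ m₂ f ((printedAt V S hW jD m₁ m₂).ωT t φ))
    (hdense : ∀ Φ ∈ (wmInputCM₂g V S hGR η hη hηc ι₁ V.sylvesterFrame (sylvesterFrame_formCongr V)).SK,
      toTop (wmInputCM₂g V S hGR η hη hηc ι₁ V.sylvesterFrame (sylvesterFrame_formCongr V)) Φ ∈
        closure (toTop (wmInputCM₂g V S hGR η hη hηc ι₁ V.sylvesterFrame (sylvesterFrame_formCongr V)) ''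
          (Submodule.span ℂ (Set.range fun q : FinSB ↥(maximalRealSubfield L) (Fin 6) × (printedAt V S hW jD m₁ m₂).F =>
            ins (L : Type) (frameD V) (frameD_real V) (frameD_ne V) (dW S) (dW_real S) (dW_ne S) ι₁ (datumAt V S jD (jIOf V S hW)) m₁ m₂ q.1 q.2) :
              Set (CMSchwartz (L : Type) 6)))) :
    HypCoreW (wmInputCM₂g V S hGR η hη hηc ι₁ V.sylvesterFrame (sylvesterFrame_formCongr V)) S.jT₃₄ m₁ m₂ :=
  { kind := kindOf (L : Type) (frameD V) (frameD_real V) (dW S) (dW_real S) ι₁ (datumAt V S jD (jIOf V S hW))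
    lam := lamOf (L : Type) (frameD V) (frameD_real V) (dW S) (dW_real S) ι₁ (datumAt V S jD (jIOf V S hW))
    hlam := lamOf_ne_zero (L : Type) (frameD V) (frameD_real V) (dW S) (dW_real S) ι₁ (datumAt V S jD (jIOf V S hW))
    side :=
      { FinIdx := FinSB ↥(maximalRealSubfield L) (Fin 6)
        ins := fun f => ins₃₄ V S hGR η (datumAt V S jD (jIOf V S hW)) m₁ m₂ f
        ins_mem := fun f φ => ins₃₄_mem_SK V S hGR η hη hηc ι₁ V.sylvesterFrame (sylvesterFrame_formCongr V)
          (datumAt V S jD (jIOf V S hW)) m₁ m₂ hW f φ (ins_mem_datumAt V S hGR η hη hηc hV hW jD m₁ m₂ hκ f φ)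
        dense := dense₃₄_of_dense V S hGR η hη hηc ι₁ V.sylvesterFrame (sylvesterFrame_formCongr V) (datumAt V S jD (jIOf V S hW))
          m₁ m₂ hW (FinSB ↥(maximalRealSubfield L) (Fin 6)) id hdense
        omg_ins := homg₃₄
        e := fun b u s => curve₃₄ V S (datumAt V S jD (jIOf V S hW)) b u s
        e_zero := fun b u => curve₃₄_zero V S (datumAt V S jD (jIOf V S hW)) b u
        smooth := fun b u f φ => smooth₃₄_wmInputCM₂g V S hGR η hη hηc ι₁ V.sylvesterFrame (sylvesterFrame_formCongr V)
          (datumAt V S jD (jIOf V S hW)) m₁ m₂ hW b u f φ } }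

end Pin

end HodgeCM.Model.HypCensus

/-! ## 2. The socket: row 17's census-T record from the named residual families -/

namespace HodgeCM.Model

open HodgeCM HodgeCM.Universe HodgeCM.Adelic HodgeCM.Model.HypCensus
open HodgeCM.PerL34 HodgeCM.PerL34.Fock HodgeCM.PerL34.Fock.PrintDict HodgeCM.PerL34.Annihilation
open Literature.NumberTheory.Weil1964
open Literature.NumberTheory.Automorphic (piSchwartzBruhat FinSB thinCosetTestFunₗ piSchwartzBruhatEquiv)
open Literature.NumberTheory.Automorphic.UnitaryGroup (archKappa)
open Literature.NumberTheory.GelbartRogawski1991.UnitaryDualPair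
open Literature.AlgebraicGeometry.HodgeTheory
open Literature.AlgebraicGeometry.ShimuraVarieties
open Literature.NumberTheory.Automorphic.PicardCM
open Literature.NumberTheory.Transcendental (Arapura2012_Cor_15_4_6)
open HodgeCM.Model.ThetaSpace HodgeCM.Model.ArchSideTerm HodgeCM.Model.SupplyInstance HodgeCM.Model.SupplyResidual
open NumberField.SeesawArchTorus (toAdeles printedTorusHom printedTorusHom_apply placesEquiv)
open HodgeCM.PerL34.Fock.LocalFock NumberField.SeesawTorus NumberField.SeesawArchTorus

namespace Gen12PinsP

variable
  (G : ∀ {L : CMField} {ι₁ : L →+* ℂ} (_V : HermSpace3 L ι₁) (_c : SeesawCtx L), Prop)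
  (hG : ∀ {L : CMField} {ι₁ : L →+* ℂ} (V : HermSpace3 L ι₁) (c : SeesawCtx L),
    G V c → (∀ j, 0 < (ι₁ (dW c.D j)).re) ∨ ∀ j, (ι₁ (dW c.D j)).re < 0)
  (hGR : ∀ {L : CMField} {ι₁ : L →+* ℂ} (V : HermSpace3 L ι₁) (c : SeesawCtx L),
    (cmSplittingDatum (L : Type) finProdFinEquiv (frameD V) (frameD_real V) (frameD_ne V) (dW c.D) (dW_real c.D)
      (dW_ne c.D)).CompatibleSplitting)
  (η : ∀ {L : CMField} {ι₁ : L →+* ℂ} (V : HermSpace3 L ι₁) (c : SeesawCtx L),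
    CMAdelic (L : Type) (frameD V) × CMAdelic (L : Type) (dW c.D) →* ℂˣ)
  (hη : ∀ {L : CMField} {ι₁ : L →+* ℂ} (V : HermSpace3 L ι₁) (c : SeesawCtx L),
    ∀ γU ∈ CMRat (L : Type) (frameD V), ∀ γ ∈ CMRat (L : Type) (dW c.D), η V c (γU, γ) = 1)
  (hηc : ∀ {L : CMField} {ι₁ : L →+* ℂ} (V : HermSpace3 L ι₁) (c : SeesawCtx L), Continuous fun p => ((η V c p : ℂˣ) : ℂ))
  (hGR₀ : ∀ {L : CMField} {ι₁ : L →+* ℂ} (V : HermSpace3 L ι₁) (c : SeesawCtx L),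
    (cmSplittingDatum (L : Type) (e₁) (frameD V) (frameD_real V) (frameD_ne V) (lineVec (L : Type) (dW c.D 0))
      (fun _ => dW_real c.D 0) (fun _ => dW_ne c.D 0)).CompatibleSplitting)
  (hGR₁ : ∀ {L : CMField} {ι₁ : L →+* ℂ} (V : HermSpace3 L ι₁) (c : SeesawCtx L),
    (cmSplittingDatum (L : Type) (e₁) (frameD V) (frameD_real V) (frameD_ne V) (lineVec (L : Type) (dW c.D 1))
      (fun _ => dW_real c.D 1) (fun _ => dW_ne c.D 1)).CompatibleSplitting)
  (hGR₂ : ∀ {L : CMField} {ι₁ : L →+* ℂ} (V : HermSpace3 L ι₁) (c : SeesawCtx L),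
    (cmSplittingDatum (L : Type) (e₁) (frameD V) (frameD_real V) (frameD_ne V) (lineVec (L : Type) (dW' c.D 0))
      (fun _ => dW'_real c.D 0) (fun _ => dW'_ne c.D 0)).CompatibleSplitting)
  (hGR₃ : ∀ {L : CMField} {ι₁ : L →+* ℂ} (V : HermSpace3 L ι₁) (c : SeesawCtx L),
    (cmSplittingDatum (L : Type) (e₁) (frameD V) (frameD_real V) (frameD_ne V) (lineVec (L : Type) (dW' c.D 1))
      (fun _ => dW'_real c.D 1) (fun _ => dW'_ne c.D 1)).CompatibleSplitting)
  (AG : ∀ {L : CMField} {ι₁ : L →+* ℂ} (V : HermSpace3 L ι₁) (c : SeesawCtx L), G V c → ∀ k : Fin 4,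
    ArchLineInput V (lineRepD V c.D (hGR V c) (hGR₀ V c) (hGR₁ V c) (hGR₂ V c) (hGR₃ V c) (η V c) k))

variable (hHD : exists_isReal_hodgeModel) (hI : hodgePQ_independent_of_hodgeModel)
  (h₁ : BallQuotientUniformised)  (h₃ : CMAbelianVarietyRealised)
  (h : Bool) (hA : Arapura2012_Cor_15_4_6) (μ : ∀ {L : CMField}, SeesawCtx L → Fin 4 → InfinitePlace L → ℤ)

section Context34

variable {L : CMField} {ι₁ : L →+* ℂ} (V : HermSpace3 L ι₁) (c : SeesawCtx L) (hV : IsAnisotropic L V.Hm)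

/-- **THE SOCKET — row 17's `CT` from the named residual families.**  Per good sextic context: the rows-18/19 families `hκ`, `homg₃₄`, `hdense`
of binder-2's (34) core (at the W pin `Gen12Pins.Wg … V c`, torus `jT₃₄`, exponents `(−μ c 2, −μ c 3)`), LF-continuity of the (34) pair actions of
the guarded S pin, (W-0-supply) `hsupply`, and the archimedean letter identity `harch` (∃-form, #55). -/
def Real34CensusSideT.ofCensus (hW : IsAnisotropic L c.D.gramW) (hs : (∀ j, 0 < (ι₁ (dW c.D j)).re) ∨ ∀ j, (ι₁ (dW c.D j)).re < 0)
    (jD : InfinitePlace (L : Type) → EqVar → Fin 6)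
    (hκ : ∀ k : ↥(KInfty V),
      ((η V c (kPair V c.D ι₁ V.sylvesterFrame (sylvesterFrame_formCongr V) k) : ℂˣ) : ℂ) *
          ((pinLetterChar V c.D (hGR V c) hs (kVLetters V c.D (lett V c.D k)) : Circle) : ℂ) * dVIota V c.D (lett V c.D k (cmPlace (L : Type) ι₁)) =
        ((archKappa (L : Type) V.Hm ι₁ V.sylvesterFrame (sylvesterFrame_formCongr V) k : ℂˣ) : ℂ))
    (homg₃₄ : ∀ (f : FinSB ↥(maximalRealSubfield L) (Fin 6)) (t : (printedAt V c.D hs jD (fun w => -μ c 2 w) (fun w => -μ c 3 w)).Tg)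
        (φ : (printedAt V c.D hs jD (fun w => -μ c 2 w) (fun w => -μ c 3 w)).F),
      omgW (Gen12Pins.Wg @hGR @η @hη @hηc @Gen12Pins.τSyl @Gen12Pins.TSyl @Gen12Pins.hTSyl V c)
          (printedTorusHom (kindOf (L : Type) (frameD V) (frameD_real V) (dW c.D) (dW_real c.D) ι₁ (datumAt V c.D jD (jIOf V c.D hs)))
            (lamOf (L : Type) (frameD V) (frameD_real V) (dW c.D) (dW_real c.D) ι₁ (datumAt V c.D jD (jIOf V c.D hs)))
            (lamOf_ne_zero (L : Type) (frameD V) (frameD_real V) (dW c.D) (dW_real c.D) ι₁ (datumAt V c.D jD (jIOf V c.D hs)))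
            (c.D.jT₃₄.toMonoidHom.comp (toAdeles (L : Type)))
            (pinnedVacs (kindOf (L : Type) (frameD V) (frameD_real V) (dW c.D) (dW_real c.D) ι₁ (datumAt V c.D jD (jIOf V c.D hs)))
              (fun w => -μ c 2 w) (fun w => -μ c 3 w)) t)
          (ins₃₄ V c.D (hGR V c) (η V c) (datumAt V c.D jD (jIOf V c.D hs)) (fun w => -μ c 2 w) (fun w => -μ c 3 w) f φ) =
        ins₃₄ V c.D (hGR V c) (η V c) (datumAt V c.D jD (jIOf V c.D hs)) (fun w => -μ c 2 w) (fun w => -μ c 3 w) f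
          ((printedAt V c.D hs jD (fun w => -μ c 2 w) (fun w => -μ c 3 w)).ωT t φ))
    (hdense : ∀ Φ ∈ (Gen12Pins.Wg @hGR @η @hη @hηc @Gen12Pins.τSyl @Gen12Pins.TSyl @Gen12Pins.hTSyl V c).SK,
      toTop (Gen12Pins.Wg @hGR @η @hη @hηc @Gen12Pins.τSyl @Gen12Pins.TSyl @Gen12Pins.hTSyl V c) Φ ∈
        closure (toTop (Gen12Pins.Wg @hGR @η @hη @hηc @Gen12Pins.τSyl @Gen12Pins.TSyl @Gen12Pins.hTSyl V c) ''
          (Submodule.span ℂ (Set.range fun q : FinSB ↥(maximalRealSubfield L) (Fin 6) × (printedAt V c.D hs jD (fun w => -μ c 2 w) (fun w => -μ c 3 w)).F =>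
            ins (L : Type) (frameD V) (frameD_real V) (frameD_ne V) (dW c.D) (dW_real c.D) (dW_ne c.D) ι₁ (datumAt V c.D jD (jIOf V c.D hs))
              (fun w => -μ c 2 w) (fun w => -μ c 3 w) q.1 q.2) : Set (CMSchwartz (L : Type) 6))))
    (Z₂ Z₃ : Module.Dual ℂ (thetaSpaceInputIn hHD hI h₁ h₃ ((SInstance.SGP @G @hG @hGR @η @hη @hηc @hGR₀ @hGR₁ @hGR₂ @hGR₃ @AG) V c) hV).W →ₗ[ℂ]
      SchwartzMap ((thetaSpaceInputIn hHD hI h₁ h₃ ((SInstance.SGP @G @hG @hGR @η @hη @hηc @hGR₀ @hGR₁ @hGR₂ @hGR₃ @AG) V c) hV).J →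
        mixedEmbedding.mixedSpace (thetaSpaceInputIn hHD hI h₁ h₃ ((SInstance.SGP @G @hG @hGR @η @hη @hηc @hGR₀ @hGR₁ @hGR₂ @hGR₃ @AG) V c) hV).K) ℂ)
    (hLF₂ : ((thetaSpaceInputIn hHD hI h₁ h₃ ((SInstance.SGP @G @hG @hGR @η @hη @hηc @hGR₀ @hGR₁ @hGR₂ @hGR₃ @AG) V c) hV).P 2).IsLFAction)
    (hLF₃ : ((thetaSpaceInputIn hHD hI h₁ h₃ ((SInstance.SGP @G @hG @hGR @η @hη @hηc @hGR₀ @hGR₁ @hGR₂ @hGR₃ @AG) V c) hV).P 3).IsLFAction)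
    (hsupply : ∀ (x₂ x₃ : Fin 3 → FiniteAdeleRing (𝓞 ↥(maximalRealSubfield L)) ↥(maximalRealSubfield L))
        (𝔫₂ 𝔫₃ : Ideal (𝓞 ↥(maximalRealSubfield L))),
      ∃ (B₂ : ArchKTypeDataAt (thetaSpaceInputIn hHD hI h₁ h₃ ((SInstance.SGP @G @hG @hGR @η @hη @hηc @hGR₀ @hGR₁ @hGR₂ @hGR₃ @AG) V c) hV) 2 x₂ 𝔫₂)
        (B₃ : ArchKTypeDataAt (thetaSpaceInputIn hHD hI h₁ h₃ ((SInstance.SGP @G @hG @hGR @η @hη @hηc @hGR₀ @hGR₁ @hGR₂ @hGR₃ @AG) V c) hV) 3 x₃ 𝔫₃),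
        B₃.Γ₀ = B₂.Γ₀ ∧ B₂.Φarch = Z₂ ∧ B₃.Φarch = Z₃ ∧
          B₂.IsWeaklyPDiff BallForms.expP ∧
          (∀ p : Fin 2, B₂.IsPMinusKilledAlong BallForms.expP (-Complex.I • (Pi.single p 1 : Fin 2 → ℂ))) ∧
          B₃.IsWeaklyPDiff BallForms.expP ∧
          (∀ p : Fin 2, B₃.IsPMinusKilledAlong BallForms.expP (-Complex.I • (Pi.single p 1 : Fin 2 → ℂ))))
    (harch : ∃ (Tinf : SchwartzMap (Fin 3 → mixedEmbedding.mixedSpace ↥(maximalRealSubfield L)) ℂ →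
        SchwartzMap (Fin 3 → mixedEmbedding.mixedSpace ↥(maximalRealSubfield L)) ℂ →
          SchwartzMap (Fin 6 → mixedEmbedding.mixedSpace ↥(maximalRealSubfield L)) ℂ)
        (Tf : FinSB ↥(maximalRealSubfield L) (Fin 3) →ₗ[ℂ] FinSB ↥(maximalRealSubfield L) (Fin 3) →ₗ[ℂ] FinSB ↥(maximalRealSubfield L) (Fin 6)),
      (∀ (Φ₂ Φ₃ : SchwartzMap (Fin 3 → mixedEmbedding.mixedSpace ↥(maximalRealSubfield L)) ℂ) (F₂ F₃ : FinSB ↥(maximalRealSubfield L) (Fin 3)),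
        tau34 V c.D (piSchwartzBruhatEquiv ↥(maximalRealSubfield L) (Fin 3) (Φ₂ ⊗ₜ F₂))
            (piSchwartzBruhatEquiv ↥(maximalRealSubfield L) (Fin 3) (Φ₃ ⊗ₜ F₃)) =
          piSchwartzBruhatEquiv ↥(maximalRealSubfield L) (Fin 6) (Tinf Φ₂ Φ₃ ⊗ₜ Tf F₂ F₃)) ∧
      Submodule.span ℂ (Set.range fun p : FinSB ↥(maximalRealSubfield L) (Fin 3) × FinSB ↥(maximalRealSubfield L) (Fin 3) =>
        Tf p.1 p.2) = ⊤ ∧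
      ∃ a : ℂ,
        archVec₃₄ V c.D (hGR V c) (η V c) (datumAt V c.D jD (jIOf V c.D hs)) (fun w => -μ c 2 w) (fun w => -μ c 3 w)
            (printedAt V c.D hs jD (fun w => -μ c 2 w) (fun w => -μ c 3 w)).φ₀ =
          a • (Tinf (Z₂ (LinearMap.proj 0)) (Z₃ (LinearMap.proj 1)) - Tinf (Z₂ (LinearMap.proj 1)) (Z₃ (LinearMap.proj 0)))) :
    Real34CensusSideT @G @hG @hGR @η @hη @hηc @hGR₀ @hGR₁ @hGR₂ @hGR₃ @AG hHD hI h₁ h₃ h hA @μ V c hV :=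
  Real34CensusSideT.ofConcreteTau @G @hG @hGR @η @hη @hηc @hGR₀ @hGR₁ @hGR₂ @hGR₃ @AG hHD hI h₁ h₃ h hA @μ V c hV hW hs jD
    (coreW₃₄Of V c.D (hGR V c) (η V c) (hη V c) (hηc V c) hV hs jD (fun w => -μ c 2 w) (fun w => -μ c 3 w) hκ homg₃₄ hdense)
    (fun f => ⟨f, rfl⟩) Z₂ Z₃ hLF₂ hLF₃ hsupply harch

end Context34

end Gen12PinsP

end HodgeCM.Model

end
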